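import Summits.CriticalPhenomena.PercolationContinuityZ3.Theorems.PercNearOneGluingNoHeavyLowerTailKnQuestion8CoefficientwiseOffCluster
import HarnessLib

/-!
# Mirror positivity of the cluster pair under one-sided avoidance

Support file (`--supports stmt-CriticalPhenomena-4575`, closed), prover `prim-cplus-coupling` (gen 28).  No definitions, no notations, no named
facts, no sorries; standard axioms.  Memo `prim-cplus-coupling/A5-COUPLING-gen28.md` §1–§2.

Setting (prim-lf-2's `Coefficientwise` files): a finite multigraph `ends : ι → Sym2 V`; a colouring is `s : Finset ι` (red edges, `sᶜ` blue);
`C_x(s) = openCluster (ends '' s) x`; the CLUSTER PAIR of `x` is `X(s) = (C_x(s), C_x(sᶜ))` and its mirror is `X(sᶜ) = (C_x(sᶜ), C_x(s))`.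
A function `ψ : Set V → Set V → ℝ` is a MIRROR TEST FUNCTION if it is antisymmetric, `ψ a b = -ψ b a`, and monotone in its first argument
(hence antitone in its second): e.g. `ψ a b = f a - f b` (`f` monotone), or `ψ a b = 1[(a,b) ∈ 𝒰] - 1[(b,a) ∈ 𝒰]` for a set `𝒰` of pairs that is
an up-set for the twisted order `(a ⊆ a', b' ⊆ b)`.

CONJECTURE SUPER (gen 28; the complete two-colouring shadow of 'two independent conditioned clusters are pair-positively-associated', i.e. of
vdBHK's Theorem 1.3 applied twice): for vertices `x ≠ z` and mirror test functions `ψ₁, ψ₂`,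
  `0 ≤ Σ_{s : z ∉ C_x(s), z ∉ C_x(sᶜ)} ψ₁(C_x s, C_x sᶜ) · ψ₂(C_x s, C_x sᶜ)`;
equivalently `#T(𝒰 ∩ 𝒱) ≥ #T(𝒰 ∩ 𝒱^swap)` for all twisted up-sets `𝒰, 𝒱` of pairs.  With `ψ₁ = f(a) − f(b)`, `ψ₂ = g(a) − g(b)` this is the first
rung CW-PA; SUPER ⟹ MASTER (twisted transport) ⟹ CW-PA.  Exact census (min-cut over all twisted up-sets): 0 violations on all graphs with ≤ 7
vertices (16,722 rooted instances, 2.6·10⁷ closure problems), all hypergraphs on 5 vertices with ≤ 5 hyperedges, n = 8 samples.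
This file proves the ONE-SIDED case, which contains the case of a pendant conditioning vertex `z`:
* `Coefficientwise.mirror_cell_nonneg` — abstract cell lemma: on a cell `{t | t ∩ B = π}` (`π ⊆ B`), for a monotone set-valued `K` with
  `K t ⊆ K ((B \ π) ∪ (t \ B))` on the cell and mirror test functions `ψ₁, ψ₂`, `0 ≤ Σ_{cell} ψ₁(K t, K tᶜ)·ψ₂(K t, K tᶜ)`
  (the free flip `τ t = π ∪ (tᶜ \ B)` satisfies `(K(τ t), K((τ t)ᶜ)) ≤_tw (K tᶜ, K t)`, so `ψ(X(t)) + ψ(X(τ t)) ≤ 0`: both cell sums are `≤ 0`,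
  and `fkg_cell` (Harris on the cell) concludes);
* `Coefficientwise.mirror_offCluster_nonneg` — for every vertex set `A`:
  `0 ≤ Σ_{s : A ∩ C_x(s) = ∅} ψ₁(C_x s, C_x sᶜ)·ψ₂(C_x s, C_x sᶜ)`
  (cells of the red cluster of `A`, exactly as prim-lf-2's `offCluster_twoColouring_nonneg`, which is the case `ψᵢ a b = fᵢ a − fᵢ b`).
[cite: KozmaNitzan2024, Questions 8–9 (§5.5 p. 36) (context: the Question-8 pocket covariance programme)]
-/

namespace Summit.CriticalPhenomena.PercolationContinuityZ3.Theorems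

open Finset Literature.Probability.Percolation

namespace Coefficientwise

variable {ι V : Type*} [Fintype ι] [DecidableEq ι]

/-- **Mirror cell lemma.**  `π ⊆ B`; `K : Finset ι → Set V` monotone with `K t ⊆ K ((B \ π) ∪ (t \ B))` on the cell `{t | t ∩ B = π}`;
`ψ₁, ψ₂` antisymmetric and monotone in the first argument.  Then `0 ≤ Σ_{cell} ψ₁(K t, K tᶜ)·ψ₂(K t, K tᶜ)`. [this work] -/
theorem mirror_cell_nonneg (B π : Finset ι) (hπ : π ⊆ B) (K : Finset ι → Set V) (hK : Monotone K)
    (hKle : ∀ t : Finset ι, t ∩ B = π → K t ⊆ K ((B \ π) ∪ (t \ B)))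
    (ψ₁ ψ₂ : Set V → Set V → ℝ)
    (h₁a : ∀ a b, ψ₁ a b = -ψ₁ b a) (h₁m : ∀ a a' b, a ⊆ a' → ψ₁ a b ≤ ψ₁ a' b)
    (h₂a : ∀ a b, ψ₂ a b = -ψ₂ b a) (h₂m : ∀ a a' b, a ⊆ a' → ψ₂ a b ≤ ψ₂ a' b) :
    0 ≤ ∑ t ∈ univ.filter (fun t : Finset ι => t ∩ B = π), ψ₁ (K t) (K tᶜ) * ψ₂ (K t) (K tᶜ) := by
  set cell := univ.filter (fun t : Finset ι => t ∩ B = π) with hcell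
  have mem_cell : ∀ t : Finset ι, t ∈ cell ↔ t ∩ B = π := fun t => by simp [hcell]
  -- antitone in the second argument
  have h₁m' : ∀ a b b', b ⊆ b' → ψ₁ a b' ≤ ψ₁ a b := fun a b b' hbb => by
    rw [h₁a a b', h₁a a b]; linarith [h₁m b b' a hbb]
  have h₂m' : ∀ a b b', b ⊆ b' → ψ₂ a b' ≤ ψ₂ a b := fun a b b' hbb => by
    rw [h₂a a b', h₂a a b]; linarith [h₂m b b' a hbb]
  -- the two observables are monotone in `t`
  set Φ : Finset ι → ℝ := fun t => ψ₁ (K t) (K tᶜ) with hΦ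
  set Ψ : Finset ι → ℝ := fun t => ψ₂ (K t) (K tᶜ) with hΨ
  have hΦm : Monotone Φ := fun s t hst => by
    simp only [hΦ]
    exact le_trans (h₁m _ _ _ (hK hst)) (h₁m' _ _ _ (hK (compl_subset_compl.mpr hst)))
  have hΨm : Monotone Ψ := fun s t hst => by
    simp only [hΨ]
    exact le_trans (h₂m _ _ _ (hK hst)) (h₂m' _ _ _ (hK (compl_subset_compl.mpr hst)))
  -- the flip of the free coordinates
  set τ : Finset ι → Finset ι := fun t => π ∪ (tᶜ \ B) with hτ
  have facts : ∀ t : Finset ι, t ∩ B = π → ∀ i, (i ∈ π ↔ i ∈ t ∧ i ∈ B) := fun t ht i => by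
    rw [← ht]; exact Finset.mem_inter
  have memτ : ∀ t i, i ∈ τ t ↔ i ∈ π ∨ (i ∉ t ∧ i ∉ B) := fun t i => by
    simp only [hτ, Finset.mem_union, Finset.mem_sdiff, Finset.mem_compl]
  have hτcell : ∀ t, t ∩ B = π → τ t ∩ B = π := by
    intro t ht
    ext i
    simp only [Finset.mem_inter, memτ]
    have h1 := facts t ht i
    have h2 : i ∈ π → i ∈ B := fun h => hπ h
    tauto
  have hττ : ∀ t, t ∩ B = π → τ (τ t) = t := by
    intro t ht
    ext i
    rw [memτ, memτ]
    have h1 := facts t ht i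
    have h2 : i ∈ π → i ∈ B := fun h => hπ h
    tauto
  have hflip : ∀ t, t ∩ B = π → tᶜ = (B \ π) ∪ (τ t \ B) := by
    intro t ht
    ext i
    simp only [Finset.mem_compl, Finset.mem_union, Finset.mem_sdiff, memτ]
    have h1 := facts t ht i
    have h2 : i ∈ π → i ∈ B := fun h => hπ h
    tauto
  -- on the cell: `K (τ t) ⊆ K tᶜ` and `K t ⊆ K (τ t)ᶜ`
  have hKτ : ∀ t, t ∩ B = π → K (τ t) ⊆ K tᶜ := by
    intro t ht
    have h := hKle (τ t) (hτcell t ht)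
    rw [← hflip t ht] at h
    exact h
  have hKτc : ∀ t, t ∩ B = π → K t ⊆ K (τ t)ᶜ := by
    intro t ht
    have h := hKle t ht
    have e : (τ t)ᶜ = (B \ π) ∪ (t \ B) := by
      have := hflip (τ t) (hτcell t ht)
      rw [hττ t ht] at this
      exact this
    rw [e]
    exact h
  -- hence `Φ (τ t) ≤ -Φ t` on the cell, and the cell sums of `Φ`, `Ψ` are `≤ 0`
  have pair_le : ∀ (ψ : Set V → Set V → ℝ), (∀ a b, ψ a b = -ψ b a) → (∀ a a' b, a ⊆ a' → ψ a b ≤ ψ a' b) →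
      ∀ t, t ∩ B = π → ψ (K (τ t)) (K (τ t)ᶜ) ≤ -ψ (K t) (K tᶜ) := by
    intro ψ ha hm t ht
    have hm' : ∀ a b b', b ⊆ b' → ψ a b' ≤ ψ a b := fun a b b' hbb => by
      rw [ha a b', ha a b]; linarith [hm b b' a hbb]
    calc ψ (K (τ t)) (K (τ t)ᶜ) ≤ ψ (K tᶜ) (K (τ t)ᶜ) := hm _ _ _ (hKτ t ht)
      _ ≤ ψ (K tᶜ) (K t) := hm' _ _ _ (hKτc t ht)
      _ = -ψ (K t) (K tᶜ) := ha _ _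
  have sum_le : ∀ (ψ : Set V → Set V → ℝ), (∀ a b, ψ a b = -ψ b a) → (∀ a a' b, a ⊆ a' → ψ a b ≤ ψ a' b) →
      ∑ t ∈ cell, ψ (K t) (K tᶜ) ≤ 0 := by
    intro ψ ha hm
    have reindex : ∑ t ∈ cell, ψ (K (τ t)) (K (τ t)ᶜ) = ∑ t ∈ cell, ψ (K t) (K tᶜ) := by
      refine Finset.sum_bij' (fun t _ => τ t) (fun t _ => τ t) ?_ ?_ ?_ ?_ ?_
      · intro t ht; exact (mem_cell _).mpr (hτcell t ((mem_cell t).mp ht))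
      · intro t ht; exact (mem_cell _).mpr (hτcell t ((mem_cell t).mp ht))
      · intro t ht; exact hττ t ((mem_cell t).mp ht)
      · intro t ht; exact hττ t ((mem_cell t).mp ht)
      · intro t ht; rfl
    have h2 : 2 * ∑ t ∈ cell, ψ (K t) (K tᶜ) = ∑ t ∈ cell, (ψ (K t) (K tᶜ) + ψ (K (τ t)) (K (τ t)ᶜ)) := by
      rw [Finset.sum_add_distrib, reindex]; ring
    have h3 : ∑ t ∈ cell, (ψ (K t) (K tᶜ) + ψ (K (τ t)) (K (τ t)ᶜ)) ≤ 0 := by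
      refine Finset.sum_nonpos fun t ht => ?_
      have := pair_le ψ ha hm t ((mem_cell t).mp ht)
      linarith
    linarith
  have hΦs : ∑ t ∈ cell, Φ t ≤ 0 := sum_le ψ₁ h₁a h₁m
  have hΨs : ∑ t ∈ cell, Ψ t ≤ 0 := sum_le ψ₂ h₂a h₂m
  -- Harris on the cell
  have key := fkg_cell B π Φ Ψ hΦm hΨm
  have hprod : 0 ≤ (∑ t ∈ cell, Φ t) * (∑ t ∈ cell, Ψ t) := mul_nonneg_of_nonpos_of_nonpos hΦs hΨs
  rcases cell.eq_empty_or_nonempty with hce | hne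
  · simp [hce]
  · have hcard : (0 : ℝ) < (cell.card : ℝ) := by exact_mod_cast hne.card_pos
    have h1 : 0 ≤ (cell.card : ℝ) * ∑ t ∈ cell, Φ t * Ψ t := le_trans hprod key
    have h2 : 0 ≤ ∑ t ∈ cell, Φ t * Ψ t := by
      by_contra hlt
      have hlt' : ∑ t ∈ cell, Φ t * Ψ t < 0 := lt_of_not_ge hlt
      have : (cell.card : ℝ) * ∑ t ∈ cell, Φ t * Ψ t < 0 := mul_neg_of_pos_of_neg hcard hlt'
      linarith
    simpa [hΦ, hΨ] using h2

open Classical in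
/-- **Mirror positivity of the cluster pair under one-sided avoidance.**  For a finite multigraph (`ends : ι → Sym2 V`), a vertex `x`,
a vertex set `A` and mirror test functions `ψ₁, ψ₂` (antisymmetric, monotone in the first argument),
  `0 ≤ Σ_{s ⊆ ι : A ∩ C_x(s) = ∅} ψ₁(C_x(s), C_x(sᶜ))·ψ₂(C_x(s), C_x(sᶜ))`.
With `ψᵢ a b = fᵢ a − fᵢ b` this is prim-lf-2's `offCluster_twoColouring_nonneg` (the atom `T(v) ≥ 0`); the general case is the one-sided
instance of conjecture SUPER (file docstring), and gives SUPER for pendant conditioning vertices.  Proof: cells of the red cluster of `A`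
(verbatim as in `offCluster_twoColouring_nonneg`) + `mirror_cell_nonneg`. [this work] -/
theorem mirror_offCluster_nonneg (ends : ι → Sym2 V) (x : V) (A : Set V) (ψ₁ ψ₂ : Set V → Set V → ℝ)
    (h₁a : ∀ a b, ψ₁ a b = -ψ₁ b a) (h₁m : ∀ a a' b, a ⊆ a' → ψ₁ a b ≤ ψ₁ a' b)
    (h₂a : ∀ a b, ψ₂ a b = -ψ₂ b a) (h₂m : ∀ a a' b, a ⊆ a' → ψ₂ a b ≤ ψ₂ a' b) :
    0 ≤ ∑ s ∈ univ.filter (fun s : Finset ι => ∀ a ∈ A, a ∉ openCluster (ends '' (↑s : Set ι)) x),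
      ψ₁ (openCluster (ends '' (↑s : Set ι)) x) (openCluster (ends '' (↑(sᶜ) : Set ι)) x) *
        ψ₂ (openCluster (ends '' (↑s : Set ι)) x) (openCluster (ends '' (↑(sᶜ) : Set ι)) x) := by
  -- notation
  set K : Finset ι → Set V := fun s => openCluster (ends '' (↑s : Set ι)) x with hK
  set D : Finset (Finset ι) := univ.filter (fun s : Finset ι => ∀ a ∈ A, a ∉ openCluster (ends '' (↑s : Set ι)) x) with hD
  change 0 ≤ ∑ s ∈ D, ψ₁ (K s) (K sᶜ) * ψ₂ (K s) (K sᶜ)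
  have hKmono : ∀ {s t : Finset ι}, s ⊆ t → K s ⊆ K t := fun hst => openCluster_image_mono ends hst x
  have hKm : Monotone K := fun s t hst => hKmono hst
  -- the red cluster of the set `A`, the edges at a vertex set, and the cell key
  set R : Finset ι → Set V := fun s => {y | ∃ a ∈ A, y ∈ openCluster (ends '' (↑s : Set ι)) a} with hR
  set I : Set V → Finset ι := fun S => univ.filter (fun i : ι => ∃ v ∈ S, v ∈ ends i) with hI
  set key : Finset ι → Set V × Finset ι := fun s => (R s, s ∩ I (R s)) with hkey
  -- basic facts about `R`
  have R_closed : ∀ (s : Finset ι) {u w : V}, u ∈ R s → (openGraph (ends '' (↑s : Set ι))).Adj u w → w ∈ R s := by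
    intro s u w hu hadj
    obtain ⟨a, haA, hau⟩ := hu
    exact ⟨a, haA, SimpleGraph.Reachable.trans hau hadj.reachable⟩
  have mem_I : ∀ (S : Set V) (i : ι) (v : V), v ∈ S → v ∈ ends i → i ∈ I S := by
    intro S i v hv hvi
    simp only [hI, Finset.mem_filter, Finset.mem_univ, true_and]
    exact ⟨v, hv, hvi⟩
  have A_sub_R : ∀ (s : Finset ι), ∀ a ∈ A, a ∈ R s := fun s a ha => ⟨a, ha, mem_openCluster_self _ a⟩
  -- locality: a configuration agreeing with `s₀` on the edges at `R s₀` has the same red cluster of `A`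
  have locality : ∀ s₀ t : Finset ι, t ∩ I (R s₀) = s₀ ∩ I (R s₀) → R t = R s₀ := by
    intro s₀ t ht
    have agree : ∀ i, i ∈ I (R s₀) → (i ∈ t ↔ i ∈ s₀) := by
      intro i hi
      have := congrArg (fun u : Finset ι => i ∈ u) ht
      simp only [Finset.mem_inter, hi, and_true, eq_iff_iff] at this
      exact this
    have h1 : ∀ u ∈ R s₀, ∀ w, (openGraph (ends '' (↑s₀ : Set ι))).Adj u w →
        (openGraph (ends '' (↑t : Set ι))).Adj u w ∧ w ∈ R s₀ := by
      intro u hu w hadj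
      refine ⟨?_, R_closed s₀ hu hadj⟩
      rw [openGraph_image_adj] at hadj ⊢
      obtain ⟨⟨i, his, hi⟩, hne⟩ := hadj
      have hiI : i ∈ I (R s₀) := mem_I _ i u hu (by rw [hi]; exact Sym2.mem_mk_left u w)
      exact ⟨⟨i, (agree i hiI).mpr his, hi⟩, hne⟩
    have h2 : ∀ u ∈ R s₀, ∀ w, (openGraph (ends '' (↑t : Set ι))).Adj u w →
        (openGraph (ends '' (↑s₀ : Set ι))).Adj u w ∧ w ∈ R s₀ := by
      intro u hu w hadj
      have hadj' : (openGraph (ends '' (↑s₀ : Set ι))).Adj u w := by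
        rw [openGraph_image_adj] at hadj ⊢
        obtain ⟨⟨i, hit, hi⟩, hne⟩ := hadj
        have hiI : i ∈ I (R s₀) := mem_I _ i u hu (by rw [hi]; exact Sym2.mem_mk_left u w)
        exact ⟨⟨i, (agree i hiI).mp hit, hi⟩, hne⟩
      exact ⟨hadj', R_closed s₀ hu hadj'⟩
    ext y
    constructor
    · rintro ⟨a, haA, hay⟩
      obtain ⟨p⟩ := hay
      exact ((reachable_transfer (R s₀) h2 p) (A_sub_R s₀ a haA)).2
    · rintro ⟨a, haA, hay⟩
      obtain ⟨p⟩ := hay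
      exact ⟨a, haA, ((reachable_transfer (R s₀) h1 p) (A_sub_R s₀ a haA)).1⟩
  -- split the sum over `D` along the fibres of `key`
  rw [← Finset.sum_fiberwise_of_maps_to (s := D) (t := D.image key) (g := key)
    (fun s hs => Finset.mem_image_of_mem key hs)]
  refine Finset.sum_nonneg fun k hk => ?_
  obtain ⟨s₀, hs₀D, rfl⟩ := Finset.mem_image.mp hk
  have hs₀ : ∀ a ∈ A, a ∉ K s₀ := by
    have := (Finset.mem_filter.mp hs₀D).2
    simpa [hK] using this
  set S₀ : Set V := R s₀ with hS₀
  set B : Finset ι := I S₀ with hB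
  set π : Finset ι := s₀ ∩ B with hπ
  have hxS₀ : x ∉ S₀ := by
    rintro ⟨a, haA, hax⟩
    exact hs₀ a haA (SimpleGraph.Reachable.symm hax)
  -- the fibre of `key s₀` in `D` is exactly the cell `{t | t ∩ B = π}`
  have fiber_eq : D.filter (fun t => key t = key s₀) = univ.filter (fun t : Finset ι => t ∩ B = π) := by
    ext t
    simp only [Finset.mem_filter, Finset.mem_univ, true_and]
    constructor
    · rintro ⟨_, hkt⟩
      have h1 : R t = S₀ := (Prod.ext_iff.mp hkt).1
      have h2 : t ∩ I (R t) = s₀ ∩ I (R s₀) := (Prod.ext_iff.mp hkt).2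
      rw [h1] at h2
      exact h2
    · intro ht
      have hRt : R t = S₀ := locality s₀ t ht
      refine ⟨?_, ?_⟩
      · rw [hD, Finset.mem_filter]
        refine ⟨Finset.mem_univ _, fun a haA hax => ?_⟩
        have hxRt : x ∈ R t := ⟨a, haA, SimpleGraph.Reachable.symm hax⟩
        rw [hRt] at hxRt
        exact hxS₀ hxRt
      · change (R t, t ∩ I (R t)) = (R s₀, s₀ ∩ I (R s₀))
        rw [hRt]
        exact Prod.ext rfl ht
  rw [fiber_eq]
  -- on the cell, the red cluster of `x` uses no edge at `S₀`
  have offcluster : ∀ t : Finset ι, t ∩ B = π → K t ⊆ K ((B \ π) ∪ (t \ B)) := by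
    intro t ht
    have agree : ∀ i, i ∈ B → (i ∈ t ↔ i ∈ s₀) := by
      intro i hi
      have := congrArg (fun u : Finset ι => i ∈ u) ht
      simp only [hπ, Finset.mem_inter, hi, and_true, eq_iff_iff] at this
      exact this
    have htr : ∀ u ∈ S₀ᶜ, ∀ w, (openGraph (ends '' (↑t : Set ι))).Adj u w →
        (openGraph (ends '' (↑(t \ B) : Set ι))).Adj u w ∧ w ∈ S₀ᶜ := by
      intro u hu w hadj
      rw [openGraph_image_adj] at hadj
      obtain ⟨⟨i, hit, hi⟩, hne⟩ := hadj
      have hiB : i ∉ B := by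
        intro hiB
        have his₀ : i ∈ s₀ := (agree i hiB).mp hit
        have hiB' := hiB
        simp only [hB, hI, Finset.mem_filter, Finset.mem_univ, true_and] at hiB'
        obtain ⟨v, hvS, hvi⟩ := hiB'
        rw [hi, Sym2.mem_iff] at hvi
        rcases hvi with rfl | rfl
        · exact hu hvS
        · have hadj₀ : (openGraph (ends '' (↑s₀ : Set ι))).Adj v u := by
            rw [openGraph_image_adj]
            exact ⟨⟨i, his₀, by rw [hi, Sym2.eq_swap]⟩, hne.symm⟩
          exact hu (R_closed s₀ hvS hadj₀)
      have hwS : w ∈ S₀ᶜ := by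
        intro hwS
        exact hiB (mem_I S₀ i w hwS (by rw [hi]; exact Sym2.mem_mk_right u w))
      refine ⟨?_, hwS⟩
      rw [openGraph_image_adj]
      exact ⟨⟨i, Finset.mem_sdiff.mpr ⟨hit, hiB⟩, hi⟩, hne⟩
    intro y hy
    obtain ⟨p⟩ := hy
    have hreach := ((reachable_transfer S₀ᶜ htr p) hxS₀).1
    exact hKmono Finset.subset_union_right hreach
  exact mirror_cell_nonneg B π Finset.inter_subset_right K hKm offcluster ψ₁ ψ₂ h₁a h₁m h₂a h₂m

end Coefficientwise

end Summit.CriticalPhenomena.PercolationContinuityZ3.Theorems
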